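import Mathlib
import HarnessLib

/-!
# ℤ9 SPECIMEN (peeled `𝔸⁴/ℤ9`, char 3), brick Z4b part 1: the lifted action on the TERMINAL piece `P₂`
# (the `x_c`-chart ring `L₂ = k[x][(v v')⁻¹]`) — laws, unit bookkeeping, intertwining `ψ₂ ∘ σ̄ = σ̃ ∘ ψ₂`

(crux stmt-ResolutionOfSingularities-15640 `WildQuotients.WildQuotientResolution`, line `Sketch`; S1 =
stmt-ResolutionOfSingularities-17941 `CyclicQuotientFourfolds`, non-linear sector; chain w45c card-P specimen
«peeled 𝔸⁴/ℤ9», variant V-BR, brick Z4b (res-L1-w45c-idea-2 `Z9-SPECIMEN.md` §2 «x₂-chart … the stable TERMINAL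
PIECE is cut out by the norm N₂» / §4, res-D-pv-033 letters 2026-08-27T18:19:22Z, res-L1-w45c-plan-1 RULING
18:23:36Z «Z4b → stub-3»). [OURS · L1 W4.5c] — NOT a statement of any manuscript; replaces the role of no
printed item; AI-produced, kernel-checked ≠ expert-reviewed. Def-free, LAW-BASED (mould: res-L1-w45c-stub-2's
Z4T `…Z9PeeledTwistedLift`, p554744). Letters of Z0 (`k`, `n`, `a b c d : Fin n`).)

The peeled action `σ̄` (`x_a ↦ x_a`, `x_b ↦ x_b + x_a`, `x_c ↦ x_c + x_b`, `x_d ↦ x_d + x_c³ − x_a²x_c`, passengers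
fixed). On the smooth vertex chart `D₊(x_c²⁸ t)` of `V = Bl_{I₂₈} 𝔸ⁿ` the coordinates are `s = x_c`,
`x_a′ = x_a/x_c⁷`, `x_b′ = x_b/x_c⁴`, `x_d`; we re-use the slots of `k[x]` (`s ↔ X c`, `x_a′ ↔ X a`, `x_b′ ↔ X b`,
`x_d ↔ X d`): the TERMINAL SUBSTITUTION `ψ₂ : x_a ↦ X a · X c⁷, x_b ↦ X b · X c⁴` (else identity). The stable
terminal piece `P₂ = D₊(N₂²⁸ t³)` (033's `piece_eq_basicOpen_normT … 23`, `norm_g23_eq`) is the locus where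
`v := 1 + X c³ X b` (`= σ̄x_c / x_c`) and `v' := 1 − X c³ X b + X c⁶ X a` (`= σ̄²x_c / x_c`) are invertible:
`L₂ := Localization.Away (v · v') k[x]`, and `ψ₂ (N₂) = X c³ · v v'` (`term_N2`). The LIFTED ACTION `σ̃` on `L₂`
is pinned by the division-free LAWS (033 18:19:22Z)
  `σ̃ s = s v`,  `σ̃ x_a′ · v⁷ = x_a′`,  `σ̃ x_b′ · v⁴ = x_b′ + s³ x_a′`,  `σ̃ x_d = x_d + s³ − s¹⁵ x_a′²`,
passengers fixed — stated for ANY `k`-algebra map `τ : L₂ →ₐ[k] L₂` with these laws (written with the inverse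
`iv = ι v' · (v v')⁻¹` of `ι v`).

* `term_X_a/_b/_c/_of_ne`, `term_N2`; `u₂_eq`, `algebraMap_v_mul_iv`, `algebraMap_v'_mul_iv'`, `algebraMap_u_mul_J`;
* `lift_apply_v` (`σ̃ v = v'·iv`, char 3), `lift_apply_v'` (`σ̃ v' = iv`, char 3), `lift_apply_u`, `lift_apply_iv`,
  `lift_apply_iv'`, `lift_apply_J`;
* `lift_term_X_a/_b/_c/_d`, **`lift_comp_term`** — `σ̃ (ι (ψ₂ F)) = ι (ψ₂ (σ̄ F))` for every `F ∈ k[x]`.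
Parts 2/3: existence + `σ̃³ = 1`; `(σ̃ y − y) ⊆ (s³)` locally principal ⇒ Király–Lütkebohmert ⇒ `L₂^{σ̃}` regular;
the seam `Γ(P₂) ≅ L₂`.
-/

-- single-problem summit: the doubled namespace component `ResolutionOfSingularities` is forced
set_option linter.dupNamespace false

noncomputable section

open MvPolynomial

namespace Summit.ResolutionOfSingularities.ResolutionOfSingularities.Theorems.WildQuotientResolution.Z9Peeled.Terminal

variable (k : Type) [Field k] (n : ℕ) (a b c d : Fin n)

/-- `v = 1 + s³ x_b′` (slots `s = X c`, `x_b′ = X b`; local shorthand). -/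
local notation3 "v₂" => (1 + X c ^ 3 * X b : MvPolynomial (Fin n) k)
/-- `v' = 1 − s³ x_b′ + s⁶ x_a′` (local shorthand). -/
local notation3 "v₂'" => (1 - X c ^ 3 * X b + X c ^ 6 * X a : MvPolynomial (Fin n) k)
/-- `u₂ = v v'` expanded (local shorthand; the element inverted on the terminal piece). -/
local notation3 "u₂" => ((1 + X c ^ 3 * X b) * (1 - X c ^ 3 * X b + X c ^ 6 * X a) : MvPolynomial (Fin n) k)
/-- The terminal chart ring `L₂ = k[x][(v v')⁻¹]` (local shorthand). -/
local notation3 "L₂" => Localization.Away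
  ((1 + X c ^ 3 * X b) * (1 - X c ^ 3 * X b + X c ^ 6 * X a) : MvPolynomial (Fin n) k)
/-- `ι : k[x] → L₂` (local shorthand). -/
local notation3 "ι₂" => algebraMap (MvPolynomial (Fin n) k) (Localization.Away
  ((1 + X c ^ 3 * X b) * (1 - X c ^ 3 * X b + X c ^ 6 * X a) : MvPolynomial (Fin n) k))
/-- `J = (v v')⁻¹ ∈ L₂` (local shorthand). -/
local notation3 "J₂" => (IsLocalization.Away.invSelf
  ((1 + X c ^ 3 * X b) * (1 - X c ^ 3 * X b + X c ^ 6 * X a) : MvPolynomial (Fin n) k) :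
  Localization.Away ((1 + X c ^ 3 * X b) * (1 - X c ^ 3 * X b + X c ^ 6 * X a) : MvPolynomial (Fin n) k))
/-- `iv = (ι v)⁻¹ = ι v' · J` (local shorthand). -/
local notation3 "iv₂" => (algebraMap (MvPolynomial (Fin n) k) (Localization.Away
  ((1 + X c ^ 3 * X b) * (1 - X c ^ 3 * X b + X c ^ 6 * X a) : MvPolynomial (Fin n) k))
    (1 - X c ^ 3 * X b + X c ^ 6 * X a) *
  (IsLocalization.Away.invSelf
    ((1 + X c ^ 3 * X b) * (1 - X c ^ 3 * X b + X c ^ 6 * X a) : MvPolynomial (Fin n) k) :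
    Localization.Away ((1 + X c ^ 3 * X b) * (1 - X c ^ 3 * X b + X c ^ 6 * X a) : MvPolynomial (Fin n) k)))
/-- `iv' = (ι v')⁻¹ = ι v · J` (local shorthand). -/
local notation3 "iv₂'" => (algebraMap (MvPolynomial (Fin n) k) (Localization.Away
  ((1 + X c ^ 3 * X b) * (1 - X c ^ 3 * X b + X c ^ 6 * X a) : MvPolynomial (Fin n) k))
    (1 + X c ^ 3 * X b) *
  (IsLocalization.Away.invSelf
    ((1 + X c ^ 3 * X b) * (1 - X c ^ 3 * X b + X c ^ 6 * X a) : MvPolynomial (Fin n) k) :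
    Localization.Away ((1 + X c ^ 3 * X b) * (1 - X c ^ 3 * X b + X c ^ 6 * X a) : MvPolynomial (Fin n) k)))
/-- The terminal substitution `ψ₂` (local shorthand): `x_a ↦ x_a′ s⁷`, `x_b ↦ x_b′ s⁴`, rest fixed. -/
local notation3 "tm₂" => (fun i : Fin n => if i = a then X a * X c ^ 7
    else if i = b then X b * X c ^ 4 else (X i : MvPolynomial (Fin n) k))

/-! ## The terminal substitution `ψ₂` -/

/-- `ψ₂ (x_a) = x_a′ s⁷`. [OURS · L1 W4.5c] -/
theorem term_X_a : aeval tm₂ (X a : MvPolynomial (Fin n) k) = X a * X c ^ 7 := by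
  rw [aeval_X]; simp

/-- `ψ₂ (x_b) = x_b′ s⁴`. [OURS · L1 W4.5c] -/
theorem term_X_b (hab : a ≠ b) : aeval tm₂ (X b : MvPolynomial (Fin n) k) = X b * X c ^ 4 := by
  rw [aeval_X]; simp [hab.symm]

/-- `ψ₂ (x_i) = x_i` for `i ∉ {a, b}` (in particular `ψ₂ x_c = s`, `ψ₂ x_d = x_d`). [OURS · L1 W4.5c] -/
theorem term_X_of_ne {i : Fin n} (hia : i ≠ a) (hib : i ≠ b) :
    aeval tm₂ (X i : MvPolynomial (Fin n) k) = X i := by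
  rw [aeval_X]; simp [hia, hib]

/-- **`ψ₂ (N₂) = s³ · v v'`** for the invariant norm `N₂ = x_c (x_c + x_b)(x_c − x_b + x_a)`: the terminal
piece `D₊(N₂²⁸t³)` is the locus `v v' ≠ 0` of the chart (033's `norm_g23_eq`). [OURS · L1 W4.5c] -/
theorem term_N2 (hab : a ≠ b) (hac : a ≠ c) (hbc : b ≠ c) :
    aeval tm₂ (X c * (X c + X b) * (X c - X b + X a) : MvPolynomial (Fin n) k) = X c ^ 3 * u₂ := by
  simp only [map_mul, map_add, map_sub, term_X_a, term_X_b k n a b c hab,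
    term_X_of_ne k n a b c hac.symm hbc.symm]
  ring

/-! ## The units of `L₂` -/

/-- `ι u₂ = ι v · ι v'`. [folklore] -/
theorem algebraMap_u_eq : ι₂ u₂ = ι₂ v₂ * ι₂ v₂' := by rw [← map_mul]

/-- `ι v · iv = 1`. [folklore] -/
theorem algebraMap_v_mul_iv : ι₂ v₂ * iv₂ = 1 := by
  rw [← mul_assoc, ← map_mul]
  exact IsLocalization.Away.mul_invSelf _

/-- `ι v' · iv' = 1`. [folklore] -/
theorem algebraMap_v'_mul_iv' : ι₂ v₂' * iv₂' = 1 := by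
  rw [← mul_assoc, ← map_mul, show v₂' * v₂ = u₂ by ring]
  exact IsLocalization.Away.mul_invSelf _

/-- `ι u₂ · J = 1`. [folklore] -/
theorem algebraMap_u_mul_J : ι₂ u₂ * J₂ = 1 := IsLocalization.Away.mul_invSelf _

/-- `ι v = 1 + (ι s)³ ι x_b′`. [folklore] -/
theorem algebraMap_v_eq : ι₂ v₂ = 1 + ι₂ (X c) ^ 3 * ι₂ (X b) := by
  rw [map_add, map_one, map_mul, map_pow]

/-- `ι v' = 1 − (ι s)³ ι x_b′ + (ι s)⁶ ι x_a′`. [folklore] -/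
theorem algebraMap_v'_eq : ι₂ v₂' = 1 - ι₂ (X c) ^ 3 * ι₂ (X b) + ι₂ (X c) ^ 6 * ι₂ (X a) := by
  rw [map_add, map_sub, map_one, map_mul, map_pow, map_mul, map_pow]

/-- `(3 : L₂) = 0` in characteristic `3`. [folklore] -/
theorem three_eq_zero_L₂ [CharP k 3] : (3 : L₂) = 0 := by
  have h : (3 : MvPolynomial (Fin n) k) = 0 := by
    have := CharP.cast_eq_zero (MvPolynomial (Fin n) k) 3
    simpa using this
  have h' := congrArg ι₂ h
  rwa [map_ofNat, map_zero] at h'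

/-! ## Laws of a lift and their consequences (laws repeated as explicit binders) -/

/-- `ι (x_b′ + s³ x_a′) = ι x_b′ + (ι s)³ ι x_a′`. [folklore] -/
theorem algebraMap_bshift_eq : ι₂ (X b + X c ^ 3 * X a) = ι₂ (X b) + ι₂ (X c) ^ 3 * ι₂ (X a) := by
  rw [map_add, map_mul, map_pow]

/-- Powers of `ι v · iv = 1`. [folklore] -/
theorem algebraMap_v_pow_mul_iv_pow (m : ℕ) : ι₂ v₂ ^ m * iv₂ ^ m = 1 := by
  rw [← mul_pow, algebraMap_v_mul_iv, one_pow]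

-- notation-heavy localisation terms: elaboration of the unit bookkeeping needs head-room
set_option maxHeartbeats 1600000 in
/-- The `v`-identity in element form (char 3): `1 + (s v)³ · (x_b′ + s³x_a′) iv⁴ = v' · iv`. [OURS · L1 W4.5c] -/
theorem v_identity [CharP k 3] :
    1 + (ι₂ (X c) * ι₂ v₂) ^ 3 * (ι₂ (X b + X c ^ 3 * X a) * iv₂ ^ 4) = ι₂ v₂' * iv₂ := by
  have hJ := algebraMap_v_mul_iv k n a b c
  have e3 := algebraMap_v_pow_mul_iv_pow k n a b c 3
  have hV := algebraMap_v_eq k n a b c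
  have hV' := algebraMap_v'_eq k n a b c
  have hBA := algebraMap_bshift_eq k n a b c
  have h3 := three_eq_zero_L₂ k n a b c
  linear_combination (ι₂ (X c) ^ 3 * ι₂ (X b + X c ^ 3 * X a) * iv₂) * e3
    + (ι₂ (X c) ^ 3 * iv₂) * hBA + (-iv₂) * hV' + (-1 : L₂) * hJ + iv₂ * hV
    + (ι₂ (X c) ^ 3 * ι₂ (X b) * iv₂) * h3

set_option maxHeartbeats 1600000 in
/-- The `v'`-identity in element form (any characteristic):
`1 − (s v)³ (x_b′ + s³x_a′) iv⁴ + (s v)⁶ x_a′ iv⁷ = iv`. [OURS · L1 W4.5c] -/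
theorem v'_identity :
    1 - (ι₂ (X c) * ι₂ v₂) ^ 3 * (ι₂ (X b + X c ^ 3 * X a) * iv₂ ^ 4)
      + (ι₂ (X c) * ι₂ v₂) ^ 6 * (ι₂ (X a) * iv₂ ^ 7) = iv₂ := by
  have hJ := algebraMap_v_mul_iv k n a b c
  have e3 := algebraMap_v_pow_mul_iv_pow k n a b c 3
  have e6 := algebraMap_v_pow_mul_iv_pow k n a b c 6
  have hV := algebraMap_v_eq k n a b c
  have hBA := algebraMap_bshift_eq k n a b c
  linear_combination (-(ι₂ (X c) ^ 3 * ι₂ (X b + X c ^ 3 * X a) * iv₂)) * e3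
    + (ι₂ (X c) ^ 6 * ι₂ (X a) * iv₂) * e6 + (-(ι₂ (X c) ^ 3 * iv₂)) * hBA + (-1 : L₂) * hJ + iv₂ * hV

set_option maxHeartbeats 1600000 in
/-- `τ (ι v) = ι v' · iv` (char 3): `σ̃ v = 1 + s³(x_b′ + s³x_a′)/v = (1 + 2 s³x_b′ + s⁶x_a′)/v = v'/v`.
[OURS · L1 W4.5c] -/
theorem lift_apply_v [CharP k 3] (τ : L₂ →ₐ[k] L₂)
    (hC : τ (ι₂ (X c)) = ι₂ (X c * v₂))
    (hB : τ (ι₂ (X b)) = ι₂ (X b + X c ^ 3 * X a) * iv₂ ^ 4) :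
    τ (ι₂ v₂) = ι₂ v₂' * iv₂ := by
  rw [map_mul] at hC
  rw [algebraMap_v_eq, map_add, map_one, map_mul, map_pow, hC, hB]
  exact v_identity k n a b c

set_option maxHeartbeats 1600000 in
/-- `τ (ι v') = iv` (any characteristic): `σ̃ v' = 1 − s³(x_b′ + s³x_a′)/v + s⁶x_a′/v = (v − s³x_b′)/v = 1/v`.
[OURS · L1 W4.5c] -/
theorem lift_apply_v' (τ : L₂ →ₐ[k] L₂)
    (hC : τ (ι₂ (X c)) = ι₂ (X c * v₂)) (hA : τ (ι₂ (X a)) = ι₂ (X a) * iv₂ ^ 7)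
    (hB : τ (ι₂ (X b)) = ι₂ (X b + X c ^ 3 * X a) * iv₂ ^ 4) :
    τ (ι₂ v₂') = iv₂ := by
  rw [map_mul] at hC
  have e : τ (ι₂ v₂') = τ (1 - ι₂ (X c) ^ 3 * ι₂ (X b) + ι₂ (X c) ^ 6 * ι₂ (X a)) := by
    rw [algebraMap_v'_eq]
  rw [e, map_add, map_sub, map_one, map_mul, map_pow, map_mul, map_pow, hC, hB, hA]
  exact v'_identity k n a b c

set_option maxHeartbeats 1600000 in
/-- `τ (ι u₂) = ι v' · iv²` (char 3). [OURS · L1 W4.5c] -/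
theorem lift_apply_u [CharP k 3] (τ : L₂ →ₐ[k] L₂)
    (hC : τ (ι₂ (X c)) = ι₂ (X c * v₂)) (hA : τ (ι₂ (X a)) = ι₂ (X a) * iv₂ ^ 7)
    (hB : τ (ι₂ (X b)) = ι₂ (X b + X c ^ 3 * X a) * iv₂ ^ 4) :
    τ (ι₂ u₂) = ι₂ v₂' * iv₂ ^ 2 := by
  rw [algebraMap_u_eq, map_mul, lift_apply_v k n a b c τ hC hB, lift_apply_v' k n a b c τ hC hA hB]
  ring

set_option maxHeartbeats 1600000 in
/-- `τ iv = ι v · iv'` (char 3). [OURS · L1 W4.5c] -/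
theorem lift_apply_iv [CharP k 3] (τ : L₂ →ₐ[k] L₂)
    (hC : τ (ι₂ (X c)) = ι₂ (X c * v₂))
    (hB : τ (ι₂ (X b)) = ι₂ (X b + X c ^ 3 * X a) * iv₂ ^ 4) :
    τ iv₂ = ι₂ v₂ * iv₂' := by
  have hJ := algebraMap_v_mul_iv k n a b c
  have h2 := algebraMap_v'_mul_iv' k n a b c
  have e1 : τ (ι₂ v₂) * τ iv₂ = 1 := by rw [← map_mul, hJ, map_one]
  rw [lift_apply_v k n a b c τ hC hB] at e1
  linear_combination (ι₂ v₂ * iv₂') * e1 - (τ iv₂ * (ι₂ v₂' * iv₂')) * hJ - τ iv₂ * h2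

set_option maxHeartbeats 1600000 in
/-- `τ iv' = ι v` (any characteristic). [OURS · L1 W4.5c] -/
theorem lift_apply_iv' (τ : L₂ →ₐ[k] L₂)
    (hC : τ (ι₂ (X c)) = ι₂ (X c * v₂)) (hA : τ (ι₂ (X a)) = ι₂ (X a) * iv₂ ^ 7)
    (hB : τ (ι₂ (X b)) = ι₂ (X b + X c ^ 3 * X a) * iv₂ ^ 4) :
    τ iv₂' = ι₂ v₂ := by
  have hJ := algebraMap_v_mul_iv k n a b c
  have h2 := algebraMap_v'_mul_iv' k n a b c
  have e1 : τ (ι₂ v₂') * τ iv₂' = 1 := by rw [← map_mul, h2, map_one]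
  rw [lift_apply_v' k n a b c τ hC hA hB] at e1
  linear_combination (ι₂ v₂) * e1 - τ iv₂' * hJ

/-- `J = iv · iv'`. [folklore] -/
theorem J_eq_iv_mul_iv' : J₂ = iv₂ * iv₂' := by
  have hU := algebraMap_u_mul_J k n a b c
  rw [algebraMap_u_eq] at hU
  linear_combination (-J₂) * hU

set_option maxHeartbeats 1600000 in
/-- `τ J = (ι v)² · iv'` (char 3). [OURS · L1 W4.5c] -/
theorem lift_apply_J [CharP k 3] (τ : L₂ →ₐ[k] L₂)
    (hC : τ (ι₂ (X c)) = ι₂ (X c * v₂)) (hA : τ (ι₂ (X a)) = ι₂ (X a) * iv₂ ^ 7)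
    (hB : τ (ι₂ (X b)) = ι₂ (X b + X c ^ 3 * X a) * iv₂ ^ 4) :
    τ J₂ = ι₂ v₂ ^ 2 * iv₂' := by
  conv_lhs => rw [J_eq_iv_mul_iv' k n a b c]
  rw [map_mul, lift_apply_iv k n a b c τ hC hB, lift_apply_iv' k n a b c τ hC hA hB]
  ring

/-! ## `ψ₂ ∘ σ̄ = σ̃ ∘ ψ₂` -/

set_option maxHeartbeats 1600000 in
/-- On `x_a`: `τ (ι (x_a′ s⁷)) = ι (x_a′ s⁷)`. [OURS · L1 W4.5c] -/
theorem lift_term_X_a (τ : L₂ →ₐ[k] L₂)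
    (hC : τ (ι₂ (X c)) = ι₂ (X c * v₂)) (hA : τ (ι₂ (X a)) = ι₂ (X a) * iv₂ ^ 7) :
    τ (ι₂ (X a * X c ^ 7)) = ι₂ (X a * X c ^ 7) := by
  have e7 := algebraMap_v_pow_mul_iv_pow k n a b c 7
  rw [map_mul] at hC
  rw [map_mul, map_pow, map_mul, map_pow, hC, hA]
  linear_combination (ι₂ (X a) * ι₂ (X c) ^ 7) * e7

set_option maxHeartbeats 1600000 in
/-- On `x_b`: `τ (ι (x_b′ s⁴)) = ι (x_b′ s⁴ + x_a′ s⁷)`. [OURS · L1 W4.5c] -/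
theorem lift_term_X_b (τ : L₂ →ₐ[k] L₂)
    (hC : τ (ι₂ (X c)) = ι₂ (X c * v₂)) (hB : τ (ι₂ (X b)) = ι₂ (X b + X c ^ 3 * X a) * iv₂ ^ 4) :
    τ (ι₂ (X b * X c ^ 4)) = ι₂ (X b * X c ^ 4 + X a * X c ^ 7) := by
  have e4 := algebraMap_v_pow_mul_iv_pow k n a b c 4
  have hBA := algebraMap_bshift_eq k n a b c
  rw [map_mul] at hC
  rw [show ι₂ (X b * X c ^ 4 + X a * X c ^ 7) = ι₂ (X b) * ι₂ (X c) ^ 4 + ι₂ (X a) * ι₂ (X c) ^ 7 by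
    rw [map_add, map_mul, map_pow, map_mul, map_pow]]
  rw [map_mul, map_pow, map_mul, map_pow, hC, hB]
  linear_combination (ι₂ (X b + X c ^ 3 * X a) * ι₂ (X c) ^ 4) * e4 + (ι₂ (X c) ^ 4) * hBA

/-- On `x_c`: `τ (ι s) = ι (s + x_b′ s⁴)`. [OURS · L1 W4.5c] -/
theorem lift_term_X_c (τ : L₂ →ₐ[k] L₂) (hC : τ (ι₂ (X c)) = ι₂ (X c * v₂)) :
    τ (ι₂ (X c)) = ι₂ (X c + X b * X c ^ 4) := by
  rw [hC]; exact congrArg ι₂ (by ring)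

-- the `MvPolynomial.algHom_ext` step with the substitution lambda needs head-room
set_option maxHeartbeats 1600000 in
/-- **`ψ₂ ∘ σ̄ = σ̃ ∘ ψ₂`**: `τ (ι (ψ₂ F)) = ι (ψ₂ (σ̄ F))` for every `F ∈ k[x]`. [OURS · L1 W4.5c] -/
theorem lift_comp_term (σ : MvPolynomial (Fin n) k ≃ₐ[k] MvPolynomial (Fin n) k)
    (hb : σ (X b) = X b + X a) (hc : σ (X c) = X c + X b)
    (hd : σ (X d) = X d + X c ^ 3 - X a ^ 2 * X c)
    (hσ : ∀ i, i ≠ b → i ≠ c → i ≠ d → σ (X i) = X i)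
    (hab : a ≠ b) (hac : a ≠ c) (had : a ≠ d) (hbc : b ≠ c) (hbd : b ≠ d)
    (τ : L₂ →ₐ[k] L₂)
    (hC : τ (ι₂ (X c)) = ι₂ (X c * v₂)) (hA : τ (ι₂ (X a)) = ι₂ (X a) * iv₂ ^ 7)
    (hB : τ (ι₂ (X b)) = ι₂ (X b + X c ^ 3 * X a) * iv₂ ^ 4)
    (hD : τ (ι₂ (X d)) = ι₂ (X d + X c ^ 3 - X c ^ 15 * X a ^ 2))
    (hfix : ∀ i, i ≠ a → i ≠ b → i ≠ c → i ≠ d → τ (ι₂ (X i)) = ι₂ (X i))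
    (F : MvPolynomial (Fin n) k) :
    τ (ι₂ (aeval tm₂ F)) = ι₂ (aeval tm₂ (σ F)) := by
  have ha : σ (X a) = X a := hσ a hab hac had
  -- the variables
  have hX : ∀ i : Fin n, τ (ι₂ (aeval tm₂ (X i : MvPolynomial (Fin n) k))) =
      ι₂ (aeval tm₂ (σ (X i))) := by
    intro i
    by_cases hia : i = a
    · rw [hia, ha, term_X_a]
      exact lift_term_X_a k n a b c τ hC hA
    by_cases hib : i = b
    · rw [hib, hb, map_add (aeval (R := k) tm₂), term_X_a, term_X_b k n a b c hab]
      exact lift_term_X_b k n a b c τ hC hB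
    by_cases hic : i = c
    · rw [hic, hc, map_add (aeval (R := k) tm₂), term_X_of_ne k n a b c hac.symm hbc.symm,
        term_X_b k n a b c hab]
      exact lift_term_X_c k n a b c τ hC
    by_cases hid : i = d
    · rw [hid, hd, map_sub (aeval (R := k) tm₂), map_add (aeval (R := k) tm₂),
        map_mul (aeval (R := k) tm₂), map_pow (aeval (R := k) tm₂), map_pow (aeval (R := k) tm₂),
        term_X_of_ne k n a b c hac.symm hbc.symm, term_X_a,
        term_X_of_ne k n a b c had.symm hbd.symm, hD]
      exact congrArg ι₂ (by ring)
    · rw [hσ i hib hic hid, term_X_of_ne k n a b c hia hib, hfix i hia hib hic hid]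
  -- both sides are `k`-algebra maps `k[x] → L₂`
  let ιA : MvPolynomial (Fin n) k →ₐ[k] L₂ := IsScalarTower.toAlgHom k (MvPolynomial (Fin n) k) L₂
  let Φ₁ : MvPolynomial (Fin n) k →ₐ[k] L₂ := τ.comp (ιA.comp (aeval tm₂))
  let Φ₂ : MvPolynomial (Fin n) k →ₐ[k] L₂ :=
    (ιA.comp (aeval tm₂)).comp (σ : MvPolynomial (Fin n) k →ₐ[k] MvPolynomial (Fin n) k)
  have hΦ : Φ₁ = Φ₂ := MvPolynomial.algHom_ext fun i => hX i
  exact DFunLike.congr_fun hΦ F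

end Summit.ResolutionOfSingularities.ResolutionOfSingularities.Theorems.WildQuotientResolution.Z9Peeled.Terminal

end
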